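import Literature.NumberTheory.ModularForms.GammaTranslatesSetup
import HarnessLib

/-!
# The Vandermonde–Cramer bookkeeping for the `q`-expansion principle on `Γ(N)`

Topic `Literature/NumberTheory/ModularForms`; namespace `Literature.NumberTheory.ModularForms`.
Second of three files on the `K`-rationality of the `SL₂(ℤ)`-translates of forms on `Γ(N)`
(Shimura Thm. 6.6 / Prop. 6.9, there phrased for the modular function field `𝔉_N`).  We work with
an abstract "orbit datum": finitely many pairwise distinct forms `s_i ∈ M_{w₀}(Γ(N))` permuted by
`SL₂(ℤ)` (`s_i ∣ γ = s_{σ_γ i}`) and companions `F_i ∈ M_k(Γ(N))` permuted the same way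
(`F_i ∣ γ = F_{σ_γ i}`) — in the application `s_i = θ ∣ γ_i` runs over the translates of a form
`θ` with trivial stabiliser in `SL₂(ℤ)/±Γ(N)` and `F_i = g ∣ γ_i`.  Lagrange interpolation in the
Vandermonde matrix `V(τ) = (s_i(τ)^l)_{i,l}` (the resolvent of Shimura's proof of Thm. 6.6, cf. the
polynomial `∏ (X - f ∘ γ)` of Prop. 2.?/6.9) expresses the symmetric combinations as level-one forms:

* `vdmDet s` (`δ = det V`), `cram s F l` (`det` of `V` with column `l` replaced by `(F_i)`), and
  Cramer's rule `δ F_i = ∑_l s_i^l · cram_l` (`vdmDet_mul_eq_sum`);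
* `cram_slash` — **automorphy**: `cram_l ∣_{k + w₀(T-l)} γ = sign(σ_γ) cram_l`, `T = ∑_{l<r} l`
  (rows are permuted by `σ_γ`, column `j` is rescaled by `j(γ,τ)^{w₀ j}` resp. `j(γ,τ)^k`), and
  `vdmDet_slash`; hence `vdmDet · cram_l` is `SL₂(ℤ)`-invariant (`sign² = 1`);
* holomorphy and boundedness at `i∞` of these determinants, so that
  `vdmDet s ∈ M_{w₀T}(Γ(N))`, `cram_l ∈ M_{k+w₀(T-l)}(Γ(N))` and
  **`vdmDet · cram_l ∈ M_{2w₀T + k - w₀ l}(SL₂(ℤ))`** (`vdmDet_mul_cram_mem_levelOne`);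
* `vdmDet_ne_zero` — `δ ≢ 0` (distinct holomorphic `s_i`, identity theorem).

Everything is proved; the definitions are the two determinants (no named fact).

## References

* [ShimuraIATAF1971] G. Shimura, *Introduction to the arithmetic theory of automorphic
  functions*, Princeton (1971), §6.1–6.2 (Thm. 6.6, Prop. 6.9), §2.1 (Prop. 2.?? the polynomial
  `∏_γ (X - f∘γ)` over `A₀(Γ(1))`).
* [DiamondShurman2005] F. Diamond, J. Shurman, *A First Course in Modular Forms*, GTM 228
  (2005), §4.2.
-/

noncomputable section

namespace Literature.NumberTheory.ModularForms

open scoped MatrixGroups Real CongruenceSubgroup Matrix ModularForm Topology Manifold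
open UpperHalfPlane hiding I
open Complex Filter Function ModularForm
open Literature.NumberTheory.EllipticCurves.ModularForms (formSpace levelOneSpace mem_formSpace
  mem_formSpace_iff coe_mem_formSpace mul_mem_formSpace pow_mem_formSpace formSpace_mono
  mdifferentiable_of_mem_formSpace slash_eq_of_mem_formSpace isBoundedAtImInfty_slash_of_mem_formSpace
  eq_zero_of_mul_eq_zero_of_mdifferentiable prod_ne_zero_of_mdifferentiable
  mdifferentiable_finset_sum mdifferentiable_finset_prod)

/-! ### Determinant bookkeeping -/

section Det

/-- **Rows permuted, columns rescaled**: if `B_{ij} = v_j A_{σ i, j}` then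
`det B = sign σ · (∏ v_j) · det A`. [folklore] -/
theorem det_eq_of_perm_scale {n : Type*} [Fintype n] [DecidableEq n] (A B : Matrix n n ℂ)
    (σ : Equiv.Perm n) (v : n → ℂ) (h : ∀ i j, B i j = v j * A (σ i) j) :
    B.det = Equiv.Perm.sign σ * (∏ j, v j) * A.det := by
  have hB : B = Matrix.of (fun i j ↦ v j * (A.submatrix σ id) i j) := by
    ext i j
    simp [h]
  rw [hB, Matrix.det_mul_row, Matrix.det_permute]
  ring

/-- `∏_j J^{e_j} = J^{∑ e_j}` for `J ≠ 0` (integer exponents). [folklore] -/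
theorem prod_zpow_eq_zpow_sum {ι : Type*} (s : Finset ι) {J : ℂ} (hJ : J ≠ 0) (e : ι → ℤ) :
    ∏ j ∈ s, J ^ e j = J ^ ∑ j ∈ s, e j := by
  classical
  induction s using Finset.induction_on with
  | empty => simp
  | insert a s ha ih => rw [Finset.prod_insert ha, Finset.sum_insert ha, ih, zpow_add₀ hJ]

/-- Holomorphy of `τ ↦ det M(τ)` for a matrix of holomorphic functions. [folklore] -/
theorem mdifferentiable_det {n : Type*} [Fintype n] [DecidableEq n] (M : ℍ → Matrix n n ℂ)
    (hM : ∀ i j, MDiff fun τ ↦ M τ i j) : MDiff fun τ ↦ (M τ).det := by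
  have : (fun τ ↦ (M τ).det) = ∑ σ : Equiv.Perm n,
      (fun _ ↦ ((Equiv.Perm.sign σ : ℤ) : ℂ)) * ∏ i, (fun τ ↦ M τ (σ i) i) := by
    funext τ
    rw [Matrix.det_apply']
    simp only [Finset.sum_apply, Pi.mul_apply, Finset.prod_apply]
  rw [this]
  exact mdifferentiable_finset_sum _ fun σ _ ↦ mdifferentiable_const.mul
    (mdifferentiable_finset_prod _ fun i _ ↦ hM _ _)

/-- Boundedness at `i∞` of `τ ↦ det M(τ)` for a matrix of functions bounded at `i∞`. [folklore] -/
theorem isBoundedAtImInfty_det {n : Type*} [Fintype n] [DecidableEq n] (M : ℍ → Matrix n n ℂ)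
    (hM : ∀ i j, IsBoundedAtImInfty fun τ ↦ M τ i j) : IsBoundedAtImInfty fun τ ↦ (M τ).det := by
  have : (fun τ ↦ (M τ).det) = ∑ σ : Equiv.Perm n,
      ((Equiv.Perm.sign σ : ℤ) : ℂ) • ∏ i, (fun τ ↦ M τ (σ i) i) := by
    funext τ
    rw [Matrix.det_apply']
    simp only [Finset.sum_apply, Pi.smul_apply, Finset.prod_apply, smul_eq_mul]
  rw [this]
  have hmem : ∀ σ : Equiv.Perm n,
      (∏ i, fun τ ↦ M τ (σ i) i) ∈ boundedFilterSubalgebra ℂ atImInfty := fun σ ↦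
    Subalgebra.prod_mem _ fun i _ ↦
      (hM (σ i) i : (fun τ ↦ M τ (σ i) i) ∈ boundedFilterSubalgebra ℂ atImInfty)
  exact Subalgebra.sum_mem _ fun σ _ ↦ Subalgebra.smul_mem _ (hmem σ) _

end Det

/-! ### The Vandermonde and Cramer determinants of an orbit datum -/

section Orbit

variable {r : ℕ} (s F : Fin r → ℍ → ℂ)

/-- The Vandermonde matrix `V(τ) = (s_i(τ)^l)_{i,l}`. [folklore] -/
def vdmMat (τ : ℍ) : Matrix (Fin r) (Fin r) ℂ := Matrix.vandermonde fun i ↦ s i τ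

/-- `δ = det V`, the Vandermonde determinant of the `s_i`, as a function on `ℍ`. [folklore] -/
def vdmDet : ℍ → ℂ := fun τ ↦ (vdmMat s τ).det

/-- `cram_l = det (V with column l replaced by (F_i)_i)` (Cramer), as a function on `ℍ`. [folklore] -/
def cram (l : Fin r) : ℍ → ℂ := fun τ ↦ ((vdmMat s τ).updateCol l fun i ↦ F i τ).det

variable {s F}

/-- `δ = ∏_{i<j} (s_j - s_i)` (Mathlib `det_vandermonde`). [folklore] -/
theorem vdmDet_eq_prod : vdmDet s = ∏ i : Fin r, ∏ j ∈ Finset.Ioi i, (s j - s i) := by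
  funext τ
  simp only [vdmDet, vdmMat, Matrix.det_vandermonde, Finset.prod_apply, Pi.sub_apply]

/-- `δ` is `cram_l` for the datum `F_i = s_i^l` (the column is put back). [folklore] -/
theorem vdmDet_eq_cram (l : Fin r) : vdmDet s = cram s (fun i ↦ s i ^ (l : ℕ)) l := by
  funext τ
  simp only [vdmDet, cram]
  congr 1
  ext i j
  by_cases hj : j = l
  · subst hj
    rw [Matrix.updateCol_self]
    simp [vdmMat, Matrix.vandermonde_apply]
  · rw [Matrix.updateCol_ne hj]

/-- **Cramer's rule**: `δ · F_i = ∑_l s_i^l · cram_l`. [folklore] -/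
theorem vdmDet_mul_eq_sum (i : Fin r) : vdmDet s * F i = ∑ l : Fin r, s i ^ (l : ℕ) * cram s F l := by
  funext τ
  have h := congrFun (Matrix.mulVec_cramer (vdmMat s τ) fun i ↦ F i τ) i
  simp only [Matrix.mulVec, dotProduct, Pi.smul_apply, smul_eq_mul] at h
  simp only [Pi.mul_apply, Finset.sum_apply, Pi.pow_apply, vdmDet, cram]
  rw [← h]
  refine Finset.sum_congr rfl fun l _ ↦ ?_
  rw [Matrix.cramer_apply]
  rfl

variable {N : ℕ} [NeZero N] {w₀ k : ℤ}

/-- Holomorphy of `cram_l`. [folklore] -/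
theorem mdifferentiable_cram (hs : ∀ i, MDiff (s i)) (hF : ∀ i, MDiff (F i)) (l : Fin r) :
    MDiff (cram s F l) := by
  refine mdifferentiable_det _ fun i j ↦ ?_
  by_cases hj : j = l
  · subst hj
    simp only [Matrix.updateCol_self]
    exact hF i
  · simp only [Matrix.updateCol_ne hj, vdmMat, Matrix.vandermonde_apply]
    exact (hs i).pow _

/-- Holomorphy of `δ`. [folklore] -/
theorem mdifferentiable_vdmDet (hs : ∀ i, MDiff (s i)) : MDiff (vdmDet s) := by
  rcases Nat.eq_zero_or_pos r with hr | hr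
  · subst hr
    have : vdmDet s = fun _ ↦ 1 := by funext τ; simp [vdmDet]
    rw [this]; exact mdifferentiable_const
  · rw [vdmDet_eq_cram (s := s) ⟨0, hr⟩]
    exact mdifferentiable_cram hs (fun i ↦ (hs i).pow _) _

/-- Boundedness of `cram_l` at `i∞`. [folklore] -/
theorem isBoundedAtImInfty_cram (hs : ∀ i, IsBoundedAtImInfty (s i))
    (hF : ∀ i, IsBoundedAtImInfty (F i)) (l : Fin r) : IsBoundedAtImInfty (cram s F l) := by
  refine isBoundedAtImInfty_det _ fun i j ↦ ?_
  by_cases hj : j = l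
  · subst hj
    simp only [Matrix.updateCol_self]
    exact hF i
  · simp only [Matrix.updateCol_ne hj, vdmMat, Matrix.vandermonde_apply]
    exact (boundedFilterSubalgebra ℂ atImInfty).pow_mem (hs i) _

/-- Boundedness of `δ` at `i∞`. [folklore] -/
theorem isBoundedAtImInfty_vdmDet (hs : ∀ i, IsBoundedAtImInfty (s i)) : IsBoundedAtImInfty (vdmDet s) := by
  rcases Nat.eq_zero_or_pos r with hr | hr
  · subst hr
    have : vdmDet s = fun _ ↦ 1 := by funext τ; simp [vdmDet]
    rw [this]; exact const_boundedAtFilter _ _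
  · rw [vdmDet_eq_cram (s := s) ⟨0, hr⟩]
    exact isBoundedAtImInfty_cram hs (fun i ↦ (boundedFilterSubalgebra ℂ atImInfty).pow_mem (hs i) _) _

/-- **`δ ≢ 0`** for pairwise distinct holomorphic `s_i` (`δ = ∏_{i<j}(s_j - s_i)` and the identity
theorem on `ℍ`). [folklore] -/
theorem vdmDet_ne_zero (hs : ∀ i, MDiff (s i)) (hinj : Function.Injective s) : vdmDet s ≠ 0 := by
  rw [vdmDet_eq_prod]
  refine (prod_ne_zero_of_mdifferentiable _ (fun i _ ↦ ?_) (fun i _ ↦ ?_)).1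
  · exact (prod_ne_zero_of_mdifferentiable _ (fun j _ ↦ (hs j).sub (hs i)) fun j hj ↦
      sub_ne_zero.mpr (hinj.ne (Finset.mem_Ioi.mp hj).ne')).2
  · exact (prod_ne_zero_of_mdifferentiable _ (fun j _ ↦ (hs j).sub (hs i)) fun j hj ↦
      sub_ne_zero.mpr (hinj.ne (Finset.mem_Ioi.mp hj).ne')).1

end Orbit

/-! ### Automorphy -/

section Automorphy

variable {r : ℕ} {s F : Fin r → ℍ → ℂ} {w₀ k : ℤ}

/-- Pointwise form of `f ∣_k γ = g`: `f(γτ) = g(τ) j(γ,τ)^k`. [folklore] -/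
theorem apply_smul_eq_of_slash_eq {f g : ℍ → ℂ} {k : ℤ} {γ : SL(2, ℤ)} (h : f ∣[k] γ = g) (τ : ℍ) :
    f (γ • τ) = g τ * denom γ τ ^ k := by
  have := congrFun h τ
  rw [SL_slash_apply] at this
  rw [← this, mul_assoc, ← zpow_add₀ (denom_ne_zero γ τ), neg_add_cancel, zpow_zero, mul_one]

/-- **Automorphy of the Cramer determinants**: if `γ` permutes the `s_i` by `σ` in weight `w₀`
and the `F_i` by `σ` in weight `k`, then
`cram_l ∣_{k + w₀ (T - l)} γ = sign(σ) · cram_l`, `T = ∑_{j<r} j`. (At `γτ` the rows of the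
matrix are those at `τ` permuted by `σ`, the column `j ≠ l` is rescaled by `j(γ,τ)^{w₀ j}` and the
column `l` by `j(γ,τ)^k`.) [cite: ShimuraIATAF1971, Thm. 6.6 (proof)] -/
theorem cram_slash (γ : SL(2, ℤ)) (σ : Equiv.Perm (Fin r))
    (hsσ : ∀ i, s i ∣[w₀] γ = s (σ i)) (hFσ : ∀ i, F i ∣[k] γ = F (σ i)) (l : Fin r) :
    cram s F l ∣[k + w₀ * (∑ j : Fin r, (j : ℤ) - l)] γ =
      ((Equiv.Perm.sign σ : ℤ) : ℂ) • cram s F l := by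
  classical
  funext τ
  rw [SL_slash_apply, Pi.smul_apply, smul_eq_mul]
  set J : ℂ := denom γ τ with hJ
  have hJ0 : J ≠ 0 := denom_ne_zero γ τ
  -- exponents of the column scalings
  let e : Fin r → ℤ := fun j ↦ if j = l then k else w₀ * j
  have hdet := det_eq_of_perm_scale ((vdmMat s τ).updateCol l fun i ↦ F i τ)
    ((vdmMat s (γ • τ)).updateCol l fun i ↦ F i (γ • τ)) σ (fun j ↦ J ^ e j) ?_
  · -- the sum of the exponents
    have hsum : ∑ j, e j = k + w₀ * (∑ j : Fin r, (j : ℤ) - l) := by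
      rw [← Finset.add_sum_erase _ _ (Finset.mem_univ l)]
      simp only [e, if_true]
      rw [Finset.sum_ite_of_false (fun j hj ↦ (Finset.mem_erase.mp hj).1), mul_sub, ← Finset.mul_sum,
        ← Finset.add_sum_erase _ (fun j : Fin r ↦ (j : ℤ)) (Finset.mem_univ l)]
      ring
    show ((vdmMat s (γ • τ)).updateCol l fun i ↦ F i (γ • τ)).det * J ^ (-(k + w₀ * (∑ j : Fin r, (j : ℤ) - l))) =
      ((Equiv.Perm.sign σ : ℤ) : ℂ) * ((vdmMat s τ).updateCol l fun i ↦ F i τ).det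
    rw [hdet, prod_zpow_eq_zpow_sum _ hJ0, hsum, zpow_neg,
      mul_inv_eq_iff_eq_mul₀ (zpow_ne_zero _ hJ0)]
    ring
  · -- the entries
    intro i j
    by_cases hj : j = l
    · subst hj
      simp only [Matrix.updateCol_self, e, if_true]
      rw [apply_smul_eq_of_slash_eq (hFσ i) τ, mul_comm]
    · simp only [Matrix.updateCol_ne hj, vdmMat, Matrix.vandermonde_apply, e, if_neg hj]
      rw [apply_smul_eq_of_slash_eq (hsσ i) τ, mul_pow, ← zpow_natCast (J ^ w₀), ← zpow_mul, mul_comm]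

/-- **Automorphy of the Vandermonde determinant**: `δ ∣_{w₀ T} γ = sign(σ) · δ`.
[cite: ShimuraIATAF1971, Thm. 6.6 (proof)] -/
theorem vdmDet_slash (γ : SL(2, ℤ)) (σ : Equiv.Perm (Fin r)) (hsσ : ∀ i, s i ∣[w₀] γ = s (σ i)) :
    vdmDet s ∣[w₀ * ∑ j : Fin r, (j : ℤ)] γ = ((Equiv.Perm.sign σ : ℤ) : ℂ) • vdmDet s := by
  rcases Nat.eq_zero_or_pos r with hr | hr
  · subst hr
    have h1 : vdmDet s = fun _ ↦ 1 := by funext τ; simp [vdmDet]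
    have hσ : σ = 1 := Subsingleton.elim _ _
    subst hσ
    simp only [Finset.univ_eq_empty, Finset.sum_empty, mul_zero, Equiv.Perm.sign_one, Units.val_one,
      Int.cast_one, one_smul, h1]
    exact ModularForm.is_invariant_one γ
  · set l : Fin r := ⟨0, hr⟩
    have hpow : ∀ i, (s i ^ (l : ℕ)) ∣[w₀ * l] γ = s (σ i) ^ (l : ℕ) := by
      intro i
      simp [l]
      exact ModularForm.is_invariant_one γ
    have := cram_slash γ σ hsσ hpow l
    rw [← vdmDet_eq_cram] at this
    convert this using 2
    simp only [l, Nat.cast_zero, mul_zero, zero_add, sub_zero]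

end Automorphy

/-! ### Membership: the determinants are forms on `Γ(N)`, their product is of level one -/

section Membership

variable {N : ℕ} [NeZero N] {r : ℕ} {w₀ k : ℤ} {s F : Fin r → ℍ → ℂ}
  {σ : SL(2, ℤ) → Equiv.Perm (Fin r)}

/-- Members of `formSpace Γ k` are bounded at `i∞`. [folklore] -/
theorem isBoundedAtImInfty_of_mem_formSpace {Γ : Subgroup (GL (Fin 2) ℝ)} [Γ.HasDetOne]
    [Γ.IsArithmetic] {k : ℤ} {f : ℍ → ℂ} (hf : f ∈ formSpace Γ k) : IsBoundedAtImInfty f := by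
  have := isBoundedAtImInfty_slash_of_mem_formSpace hf 1
  rwa [map_one, map_one, SlashAction.slash_one] at this

/-- `sign(σ)² = 1` in `ℂ`. [folklore] -/
theorem sign_mul_sign (ϖ : Equiv.Perm (Fin r)) :
    ((Equiv.Perm.sign ϖ : ℤ) : ℂ) * ((Equiv.Perm.sign ϖ : ℤ) : ℂ) = 1 := by
  rw [← Int.cast_mul, ← Units.val_mul, Int.units_mul_self, Units.val_one, Int.cast_one]

omit [NeZero N] in
/-- An element of `Γ(N)` permutes the (pairwise distinct, `Γ(N)`-invariant) `s_i` trivially.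
[folklore] -/
theorem perm_eq_one_of_mem_Gamma (hs : ∀ i, s i ∈ formSpace (CongruenceSubgroup.Gamma N) w₀)
    (hsσ : ∀ γ i, s i ∣[w₀] γ = s (σ γ i)) (hinj : Function.Injective s)
    {γ : SL(2, ℤ)} (hγ : γ ∈ CongruenceSubgroup.Gamma N) : σ γ = 1 := by
  ext i
  have h1 : s i ∣[w₀] γ = s i :=
    slash_eq_of_mem_formSpace (hs i) (γ := Matrix.SpecialLinearGroup.mapGL ℝ γ) ⟨γ, hγ, rfl⟩
  rw [hsσ γ i] at h1
  simpa using congrArg Fin.val (hinj h1)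

/-- **`cram_l ∈ M_{k + w₀(T - l)}(Γ(N))`**. [cite: ShimuraIATAF1971, Thm. 6.6 (proof)] -/
theorem cram_mem_formSpace (hs : ∀ i, s i ∈ formSpace (CongruenceSubgroup.Gamma N) w₀)
    (hF : ∀ i, F i ∈ formSpace (CongruenceSubgroup.Gamma N) k)
    (hsσ : ∀ γ i, s i ∣[w₀] γ = s (σ γ i)) (hFσ : ∀ γ i, F i ∣[k] γ = F (σ γ i))
    (hinj : Function.Injective s) (l : Fin r) :
    cram s F l ∈ formSpace (CongruenceSubgroup.Gamma N) (k + w₀ * (∑ j : Fin r, (j : ℤ) - l)) := by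
  rw [mem_formSpace_iff]
  refine ⟨mdifferentiable_cram (fun i ↦ mdifferentiable_of_mem_formSpace (hs i))
    (fun i ↦ mdifferentiable_of_mem_formSpace (hF i)) l, ?_, ?_⟩
  · intro δ hδ
    obtain ⟨g, hg, rfl⟩ := hδ
    have := cram_slash g (σ g) (hsσ g) (hFσ g) l
    rw [perm_eq_one_of_mem_Gamma hs hsσ hinj hg, Equiv.Perm.sign_one, Units.val_one, Int.cast_one,
      one_smul] at this
    exact this
  · intro g
    rw [← SL_slash, cram_slash g (σ g) (hsσ g) (hFσ g) l]
    exact (boundedFilterSubalgebra ℂ atImInfty).smul_mem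
      (isBoundedAtImInfty_cram (fun i ↦ isBoundedAtImInfty_of_mem_formSpace (hs i))
        (fun i ↦ isBoundedAtImInfty_of_mem_formSpace (hF i)) l) _

/-- **`δ ∈ M_{w₀T}(Γ(N))`**. [cite: ShimuraIATAF1971, Thm. 6.6 (proof)] -/
theorem vdmDet_mem_formSpace (hs : ∀ i, s i ∈ formSpace (CongruenceSubgroup.Gamma N) w₀)
    (hsσ : ∀ γ i, s i ∣[w₀] γ = s (σ γ i)) (hinj : Function.Injective s) :
    vdmDet s ∈ formSpace (CongruenceSubgroup.Gamma N) (w₀ * ∑ j : Fin r, (j : ℤ)) := by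
  rw [mem_formSpace_iff]
  refine ⟨mdifferentiable_vdmDet fun i ↦ mdifferentiable_of_mem_formSpace (hs i), ?_, ?_⟩
  · intro δ hδ
    obtain ⟨g, hg, rfl⟩ := hδ
    have := vdmDet_slash g (σ g) (hsσ g)
    rw [perm_eq_one_of_mem_Gamma hs hsσ hinj hg, Equiv.Perm.sign_one, Units.val_one, Int.cast_one,
      one_smul] at this
    exact this
  · intro g
    rw [← SL_slash, vdmDet_slash g (σ g) (hsσ g)]
    exact (boundedFilterSubalgebra ℂ atImInfty).smul_mem
      (isBoundedAtImInfty_vdmDet fun i ↦ isBoundedAtImInfty_of_mem_formSpace (hs i)) _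

/-- **The products `δ · cram_l` are modular forms of level one**, of weight
`w₀T + (k + w₀(T - l))`: `SL₂(ℤ)`-invariant since `sign(σ_γ)² = 1`, holomorphic, bounded at `i∞`.
These are the "symmetric functions of the conjugates" of Shimura's proof (coefficients of
`∏_γ (X - f∘γ)` / Lagrange resolvents), which are of level one. [cite: ShimuraIATAF1971, Thm. 6.6 (proof)] -/
theorem vdmDet_mul_cram_mem_levelOne (hs : ∀ i, s i ∈ formSpace (CongruenceSubgroup.Gamma N) w₀)
    (hF : ∀ i, F i ∈ formSpace (CongruenceSubgroup.Gamma N) k)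
    (hsσ : ∀ γ i, s i ∣[w₀] γ = s (σ γ i)) (hFσ : ∀ γ i, F i ∣[k] γ = F (σ γ i)) (l : Fin r) :
    vdmDet s * cram s F l ∈
      levelOneSpace (w₀ * ∑ j : Fin r, (j : ℤ) + (k + w₀ * (∑ j : Fin r, (j : ℤ) - l))) := by
  have hsd := fun i ↦ mdifferentiable_of_mem_formSpace (hs i)
  have hFd := fun i ↦ mdifferentiable_of_mem_formSpace (hF i)
  have hsb := fun i ↦ isBoundedAtImInfty_of_mem_formSpace (hs i)
  have hFb := fun i ↦ isBoundedAtImInfty_of_mem_formSpace (hF i)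
  have hinv : ∀ g : SL(2, ℤ), (vdmDet s * cram s F l) ∣[w₀ * ∑ j : Fin r, (j : ℤ) +
      (k + w₀ * (∑ j : Fin r, (j : ℤ) - l))] g = vdmDet s * cram s F l := by
    intro g
    rw [ModularForm.mul_slash_SL2, vdmDet_slash g (σ g) (hsσ g), cram_slash g (σ g) (hsσ g) (hFσ g) l,
      smul_mul_smul_comm, sign_mul_sign, one_smul]
  rw [show levelOneSpace (w₀ * ∑ j : Fin r, (j : ℤ) + (k + w₀ * (∑ j : Fin r, (j : ℤ) - l))) =
    formSpace 𝒮ℒ _ from rfl, mem_formSpace_iff]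
  refine ⟨(mdifferentiable_vdmDet hsd).mul (mdifferentiable_cram hsd hFd l), ?_, ?_⟩
  · rintro _ ⟨g, -, rfl⟩
    exact hinv g
  · intro g
    rw [← SL_slash, hinv g]
    exact (isBoundedAtImInfty_vdmDet hsb).mul (isBoundedAtImInfty_cram hsb hFb l)

end Membership

end Literature.NumberTheory.ModularForms

end
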